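import Summits.AnomalousDissipation.AnomalousDissipation.Theorems.SolenoidalFractalHomogenisationRealisedQuasiStaticCellLawUpperSomeGalerkin
import Summits.AnomalousDissipation.AnomalousDissipation.Theorems.SolenoidalFractalHomogenisationRealisedQuasiStaticCellLawUpperSomeFrames
import Summits.AnomalousDissipation.AnomalousDissipation.Theorems.SolenoidalFractalHomogenisationRealisedQuasiStaticCellLawUpperSomeIso
import Summits.AnomalousDissipation.AnomalousDissipation.Theorems.SolenoidalFractalHomogenisationRealisedQuasiStaticCellLawUpperSomeBudget
import Summits.AnomalousDissipation.AnomalousDissipation.Theorems.SolenoidalFractalHomogenisationRealisedQuasiStaticCellLawUpperSomeDatum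
import Summits.AnomalousDissipation.AnomalousDissipation.Theorems.SolenoidalFractalHomogenisationRealisedQuasiStaticCellLawUpperSomeCosine
import Summits.AnomalousDissipation.AnomalousDissipation.Theorems.SolenoidalFractalHomogenisationRealisedQuasiStaticCellLawIsotropicStretch
import Summits.AnomalousDissipation.AnomalousDissipation.Theorems.SolenoidalFractalHomogenisationRealisedQuasiStaticCellLawWeakFarSlotAlgebra
import HarnessLib

/-!
# K2R `RealisedQuasiStaticCellLaw`, line `floquet-bloch`, stub `stub_upperSome`: the Galerkin lower bound at the
# replayed cell word (helper; `--supports stmt-AnomalousDissipation-20446`)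

Summits-side helper file (everything proved; no definitions, no named facts). `upperSome_cell` instantiates
`upperSome_galerkin_lower` at the replayed cell word `W″ = (cubatureWord.stretch M).stretch (1/ν)`, `κ = ν/n²`, for the
single-mode datum `Re(e_ℓ)p` (`‖p‖ = 1`, `p ⊥ ℓ`): under `0 < δ ≤ 1`, `δ²M ≥ 1000`, `10⁴M‖ℓ‖/(nν) ≤ δ` and
`‖ℓ‖/n ≤ δ/(10⁹M)` the Galerkin coefficients satisfy, eventually in `N` and for every `t ≥ 0`,
`2⁻²⁹·exp(-8π²‖ℓ‖²(1 + (1+δ)(1-4ρ/3)c₀/ν²)(ν/n²)t) ≤ ‖α_N(t)(ℓ)‖² + ‖α_N(t)(-ℓ)‖²`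
(frames from `upperSome_frames`, isotropy from `upperSome_iso`, the numeric hypotheses from the `cell_*` scalar lemmas,
the rate budget from `cell_budget`, the data from `singleMode_galerkin_*`).
This is NOT a proof of Onsager's conjecture nor of anomalous dissipation.
-/

set_option linter.dupNamespace false

noncomputable section

namespace Summit.AnomalousDissipation.AnomalousDissipation.Theorems.SolenoidalFractalHomogenisation.RealisedQuasiStaticCellLaw

open Set MeasureTheory Filter Topology Function Matrix
open scoped InnerProductSpace RealInnerProductSpace ComplexConjugate Matrix BigOperators
open Literature.Analysis Literature.Analysis.FunctionSpaces Literature.Analysis.FunctionSpaces.Torus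
open Literature.Analysis.FluidPDE Literature.Analysis.FluidPDE.LatticeShear

set_option maxHeartbeats 1600000 in
/-- **The Galerkin lower bound at the cell word.** See the module docstring. -/
theorem upperSome_cell {δ M ν : ℝ} (hδ : 0 < δ) (hδ1 : δ ≤ 1) (hM : 0 < M) (hMδ : 1000 ≤ δ ^ 2 * M) (hν : 0 < ν)
    {n : ℕ} (hn : 0 < n) (hκ : 0 < ν / (n : ℝ) ^ 2) (W' : LatticeWord 26)
    (hW' : W' = (cubatureWord.stretch M hM).stretch (1 / ν) (one_div_pos.mpr hν)) {ℓ : Fin 3 → ℤ} (hℓ : ℓ ≠ 0)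
    (hGs : 10 ^ 4 * M * (‖latticeVec ℓ‖ / ((n : ℝ) * ν)) ≤ δ) (hrr : ‖latticeVec ℓ‖ / (n : ℝ) ≤ δ / (10 ^ 9 * M))
    {p : EuclideanSpace ℝ (Fin 3)} (hp1 : ‖p‖ = 1) (hp : ⟪p, latticeVec ℓ⟫ = 0) :
    ∀ᶠ N in atTop, ∀ t, 0 ≤ t →
      1 / 2 ^ 29 * Real.exp (-(8 * Real.pi ^ 2 * ‖latticeVec ℓ‖ ^ 2 *
            (1 + (1 + δ) * ((1 - 4 * cubatureWord.ramp / 3) * c0) / ν ^ 2) * ν / (n:ℝ) ^ 2) * t) ≤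
        ‖(pvSetup_cell W' hn hκ.le ℓ (memSobolev_one_singleMode ℓ p) (isWeaklyDivFree_singleMode ℓ hp)
            (hasZeroMean_singleMode hℓ p) (mFourierCoeff_singleMode_eq_zero_of_not_sector ℓ p n)).galerkinCoeffAt N t ℓ‖ ^ 2 +
        ‖(pvSetup_cell W' hn hκ.le ℓ (memSobolev_one_singleMode ℓ p) (isWeaklyDivFree_singleMode ℓ hp)
            (hasZeroMean_singleMode hℓ p) (mFourierCoeff_singleMode_eq_zero_of_not_sector ℓ p n)).galerkinCoeffAt N t (-ℓ)‖ ^ 2 := by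
  classical
  have hπ := pi_sq_bounds
  have hπ0 : 0 < Real.pi := Real.pi_pos
  have hn' : (0 : ℝ) < n := by exact_mod_cast hn
  have hM1 : 1000 ≤ M := by nlinarith [mul_le_mul_of_nonneg_right (show δ ^ 2 ≤ 1 by nlinarith) hM.le]
  have hρ : cubatureWord.ramp = 1 / 2 := (cubature_phase_fields 0).2.2.2
  -- the slot constants of `W'`
  have hcs := fun j => cellSlot_formulas cubatureWord hM hν hn j ℓ
  have hfm : ∀ j, (W'.phase j).m = (cubatureWord.phase j).m := fun j => by rw [hW']; exact (hcs j).1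
  have hfe : ∀ j, (W'.phase j).e = (cubatureWord.phase j).e := fun j => by rw [hW']; exact (hcs j).2.1
  have hfφ : ∀ j, (W'.phase j).φ = (cubatureWord.phase j).φ := fun j => by rw [hW']; exact (hcs j).2.2.1
  have hfτ : ∀ j, (W'.phase j).τ = M * (cubatureWord.phase j).τ / ν := fun j => by rw [hW']; exact (hcs j).2.2.2.1
  have hframp : W'.ramp = 1 / 2 := by rw [hW', (hcs 0).2.2.2.2.1, hρ]
  have hfP : W'.period = M * 3720 / ν := by rw [hW', (hcs 0).2.2.2.2.2.1, period_cubatureWord]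
  have hΛ' := fun j => (hcs j).2.2.2.2.2.2.1
  have hg' := fun j => (hcs j).2.2.2.2.2.2.2.2.1
  clear hcs
  have hslot := fun j => cubature_slot_bounds j
  have hτu : ∀ j, (cubatureWord.phase j).τ ≤ 40 * freqNormSq (cubatureWord.phase j).m ^ 2 := fun j => by
    rw [← (hslot j).2.2.1]; exact (cubatureWord_slot_bounds j).2.2.2.2
  have hτsum : ∑ j, (cubatureWord.phase j).τ = 3720 := period_cubatureWord
  have hτle : ∀ j, (cubatureWord.phase j).τ ≤ 3720 := fun j => by
    rw [← hτsum]
    exact Finset.single_le_sum (fun i _ => (cubatureWord.phase i).τ_pos.le) (Finset.mem_univ j)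
  -- the sector
  set A : ℝ := ‖latticeVec ℓ‖ with hA
  have ha1 : 1 ≤ A := one_le_norm_latticeVec hℓ
  have hAf : freqNormSq ℓ = A ^ 2 := (norm_latticeVec_sq ℓ).symm
  obtain ⟨G, hGd⟩ : ∃ G : ℝ, G = A / ((n : ℝ) * ν) := ⟨_, rfl⟩
  obtain ⟨rr, hrd⟩ : ∃ rr : ℝ, rr = A / (n : ℝ) := ⟨_, rfl⟩
  rw [← hGd] at hGs
  rw [← hrd] at hrr
  have hG0 : 0 ≤ G := by rw [hGd]; positivity
  have hrr0 : 0 ≤ rr := by rw [hrd]; positivity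
  have hrr1 : rr ≤ 1 / 10 ^ 12 := hrr.trans (by rw [div_le_div_iff₀ (by positivity) (by norm_num)]; nlinarith)
  have hAn : A = rr * n := by rw [hrd]; field_simp
  have h8n : 8 * A ≤ n := by rw [hAn]; nlinarith
  have hℓn : 2 * A ≤ n := by linarith
  have hKnorm : ∀ j, ‖latticeVec (fun i => (W'.phase j).m i * (n : ℤ))‖ = (n : ℝ) * ‖latticeVec (cubatureWord.phase j).m‖ :=
    fun j => by rw [hfm j]; exact (dot_cast_cellFreq ℓ _ n).2
  have h8 : ∀ j, 8 * A ≤ ‖latticeVec (fun i => (W'.phase j).m i * (n : ℤ))‖ := fun j => by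
    rw [hKnorm j]
    have := (hslot j).2.2.2.1
    nlinarith
  have hKf : ∀ j, freqNormSq (fun i => (W'.phase j).m i * (n : ℤ)) = (n : ℝ) ^ 2 * freqNormSq (cubatureWord.phase j).m :=
    fun j => by rw [hfm j, freqNormSq_cellFreq]
  have hKf0 : ∀ j, 0 < freqNormSq (fun i => (W'.phase j).m i * (n : ℤ)) := fun j => by rw [hKf j]; have := (hslot j).1; positivity
  -- the Galerkin radius
  refine Filter.eventually_atTop.2 ⟨⌈A⌉₊ + 2 * n, fun N hN t ht => ?_⟩
  have hNr : A + 2 * n ≤ N := by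
    have h1 : (⌈A⌉₊ : ℝ) + 2 * n ≤ N := by exact_mod_cast hN
    exact le_trans (by linarith [Nat.le_ceil A]) h1
  have hball : ∀ j, ∀ J : ℤ, |J| ≤ 1 → ℓ + J • (fun i => (W'.phase j).m i * (n : ℤ)) ∈ freqBall N := by
    intro j J hJ
    rw [mem_freqBall, ← norm_latticeVec_sq, latticeVec_coset]
    have hB2 : ‖latticeVec (cubatureWord.phase j).m‖ ≤ 2 := by nlinarith [(hslot j).2.1, (hslot j).2.2.1, (hslot j).2.2.2.1]
    have hJ' : |(J : ℝ)| ≤ 1 := by exact_mod_cast hJ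
    have h1 : ‖latticeVec ℓ + (J : ℝ) • latticeVec (fun i => (W'.phase j).m i * (n : ℤ))‖ ≤ A + 2 * n := by
      refine (norm_add_le _ _).trans ?_
      rw [norm_smul, Real.norm_eq_abs, hKnorm j]
      have : |(J : ℝ)| * ((n : ℝ) * ‖latticeVec (cubatureWord.phase j).m‖) ≤ 1 * ((n : ℝ) * 2) :=
        mul_le_mul hJ' (mul_le_mul_of_nonneg_left hB2 hn'.le) (by positivity) zero_le_one
      linarith
    have h0 : 0 ≤ ‖latticeVec ℓ + (J : ℝ) • latticeVec (fun i => (W'.phase j).m i * (n : ℤ))‖ := norm_nonneg _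
    nlinarith
  have hℓN : ℓ ∈ freqBall N := by simpa using hball 0 0 (by norm_num)
  have hBN : (Finset.univ.biUnion fun j : Fin 26 =>
      ({(fun i => (W'.phase j).m i * n), -(fun i => (W'.phase j).m i * n)} : Finset (Fin 3 → ℤ))) ⊆ freqBall N := by
    intro k hk
    simp only [Finset.mem_biUnion, Finset.mem_univ, true_and, Finset.mem_insert, Finset.mem_singleton] at hk
    obtain ⟨j, hj⟩ := hk
    have hKN : freqNormSq (fun i => (W'.phase j).m i * (n : ℤ)) ≤ (N : ℝ) ^ 2 := by
      rw [hKf j]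
      nlinarith [(hslot j).2.1, (hslot j).1]
    rcases hj with rfl | rfl
    · exact mem_freqBall.2 hKN
    · exact mem_freqBall.2 (by rw [freqNormSq_neg]; exact hKN)
  -- the frames
  obtain ⟨ζr, pf, Wset, hk, hdisj, hζ1, hζ0, hζK, hζm, hpf, hW, h0, h1, hm1, hs, hgap, hd0, hd1, hdm1, hσoF, hσiF⟩ :=
    upperSome_frames W' hn hℓ h8 N hball
  -- the constants
  obtain ⟨Δ, hΔd⟩ : ∃ Δ : ℝ, Δ = 7 / 16 := ⟨_, rfl⟩
  obtain ⟨ε, hεd⟩ : ∃ ε : ℝ, ε = δ / 8 := ⟨_, rfl⟩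
  obtain ⟨β, hβd⟩ : ∃ β : ℝ, β = 2 / (Δ * ε) := ⟨_, rfl⟩
  obtain ⟨η, hηd⟩ : ∃ η : ℝ, η = 8 * G ^ 2 / Real.pi ^ 4 := ⟨_, rfl⟩
  have hΔ0 : 0 < Δ := by rw [hΔd]; norm_num
  have hε0 : 0 ≤ ε := by rw [hεd]; positivity
  have hβ0 : 0 ≤ β := by rw [hβd, hΔd, hεd]; positivity
  have hΔne : Δ ≠ 0 := hΔ0.ne'
  have hεne : ε ≠ 0 := by rw [hεd]; positivity
  have hβΔε : β * Δ * ε = 2 := by rw [hβd]; field_simp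
  have hη0 : 0 ≤ η := by rw [hηd]; positivity
  obtain ⟨Λ, hΛd⟩ : ∃ Λ : Fin 26 → ℝ, ∀ j, Λ j = 4 * Real.pi ^ 2 * freqNormSq (cubatureWord.phase j).m * ν :=
    ⟨fun j => _, fun j => rfl⟩
  obtain ⟨g, hgd⟩ : ∃ g : Fin 26 → ℝ, ∀ j, g j = (∑ i, (cubatureWord.phase j).e i * (ℓ i : ℝ)) /
      (8 * Real.pi ^ 2 * freqNormSq (cubatureWord.phase j).m * ‖latticeVec (cubatureWord.phase j).m‖ * n * ν) :=
    ⟨fun j => _, fun j => rfl⟩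
  obtain ⟨T, hTd⟩ : ∃ T : Fin 26 → ℝ, ∀ j, T j = 4 * Real.pi ^ 2 * freqNormSq (cubatureWord.phase j).m * M *
      (cubatureWord.phase j).τ := ⟨fun j => _, fun j => rfl⟩
  obtain ⟨σo, hσod⟩ : ∃ σo : Fin 26 → ℝ, ∀ j, σo j =
      1 / (freqNormSq (ℓ + (-1 : ℤ) • (fun i => (W'.phase j).m i * (n : ℤ))) /
          freqNormSq (fun i => (W'.phase j).m i * (n : ℤ)) - freqNormSq ℓ / freqNormSq (fun i => (W'.phase j).m i * (n : ℤ))) +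
        1 / (freqNormSq (ℓ + (1 : ℤ) • (fun i => (W'.phase j).m i * (n : ℤ))) /
          freqNormSq (fun i => (W'.phase j).m i * (n : ℤ)) - freqNormSq ℓ / freqNormSq (fun i => (W'.phase j).m i * (n : ℤ))) :=
    ⟨fun j => _, fun j => rfl⟩
  obtain ⟨σi, hσid⟩ : ∃ σi : Fin 26 → ℝ, ∀ j, σi j =
      (pf j (-1) ⬝ᵥ pf j 0) ^ 2 / (freqNormSq (ℓ + (-1 : ℤ) • (fun i => (W'.phase j).m i * (n : ℤ))) /
          freqNormSq (fun i => (W'.phase j).m i * (n : ℤ)) - freqNormSq ℓ / freqNormSq (fun i => (W'.phase j).m i * (n : ℤ))) +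
        (pf j 0 ⬝ᵥ pf j 1) ^ 2 / (freqNormSq (ℓ + (1 : ℤ) • (fun i => (W'.phase j).m i * (n : ℤ))) /
          freqNormSq (fun i => (W'.phase j).m i * (n : ℤ)) - freqNormSq ℓ / freqNormSq (fun i => (W'.phase j).m i * (n : ℤ))) :=
    ⟨fun j => _, fun j => rfl⟩
  obtain ⟨γ, hγd⟩ : ∃ γ : Fin 26 → ℝ, ∀ j, γ j = Real.sqrt ((pf j 0 ⬝ᵥ pf j 1) ^ 2 + (pf j (-1) ⬝ᵥ pf j 0) ^ 2) :=
    ⟨fun j => _, fun j => rfl⟩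
  -- per-slot facts
  have hθ : ∀ j, |∑ i, (cubatureWord.phase j).e i * (ℓ i : ℝ)| ≤ A := fun j => coupling_abs_le _ ℓ
  have hcb := fun j => cell_coupling_bounds (hθ j) (hslot j).1 (hslot j).2.2.1 (hslot j).2.2.2.1 (hslot j).2.2.2.2
    (hτu j) hn' hν hM hGd (hgd j) (hTd j)
  have hΛpos : ∀ j, 0 < Λ j := fun j => by rw [hΛd j]; have := (hslot j).1; positivity
  have hτpos : ∀ j, 0 < (W'.phase j).τ := fun j => (W'.phase j).τ_pos
  have hΛτ : ∀ j, Λ j * (W'.phase j).τ = T j := fun j => by rw [hΛd j, hfτ j, hTd j]; field_simp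
  have hTu : ∀ j, T j ≤ 42650 * M := by
    intro j
    rw [hTd j]
    have h3 : freqNormSq (cubatureWord.phase j).m * (cubatureWord.phase j).τ ≤ 1080 := by
      have h := mul_le_mul_of_nonneg_left (hτu j) (le_trans zero_le_one (hslot j).1)
      have h27 : freqNormSq (cubatureWord.phase j).m ^ 3 ≤ 27 := by
        have := pow_le_pow_left₀ (le_trans zero_le_one (hslot j).1) (hslot j).2.1 3; norm_num at this; exact this
      nlinarith
    have : 4 * Real.pi ^ 2 * freqNormSq (cubatureWord.phase j).m * M * (cubatureWord.phase j).τ =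
        4 * Real.pi ^ 2 * M * (freqNormSq (cubatureWord.phase j).m * (cubatureWord.phase j).τ) := by ring
    rw [this]
    nlinarith [mul_le_mul_of_nonneg_left h3 (by positivity : 0 ≤ 4 * Real.pi ^ 2 * M)]
  have hd0r : ∀ j, freqNormSq ℓ / freqNormSq (fun i => (W'.phase j).m i * (n : ℤ)) ≤ rr ^ 2 := by
    intro j
    rw [hKf j, hAf, hrd, div_pow, div_le_div_iff₀ (by have := (hslot j).1; positivity) (by positivity)]
    have := (hslot j).1
    nlinarith [sq_nonneg A, mul_nonneg (sq_nonneg A) (sq_nonneg (n:ℝ))]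
  have hd00 : ∀ j, 0 ≤ freqNormSq ℓ / freqNormSq (fun i => (W'.phase j).m i * (n : ℤ)) := fun j =>
    div_nonneg (by rw [hAf]; positivity) (hKf0 j).le
  have hrK : ∀ j, A / ‖latticeVec (fun i => (W'.phase j).m i * (n : ℤ))‖ ≤ rr := by
    intro j
    rw [hKnorm j, hrd]
    have hb := (hslot j).2.2.2.1
    rw [div_le_div_iff₀ (by positivity) hn']
    nlinarith [mul_nonneg (le_trans zero_le_one ha1) hn'.le]
  have hrK1 : ∀ j, A / ‖latticeVec (fun i => (W'.phase j).m i * (n : ℤ))‖ ≤ 1 := fun j =>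
    (hrK j).trans (by linarith)
  -- the weights
  have hσlow : ∀ j, 1 ≤ σo j ∧ ((pf j 0 ⬝ᵥ pf j 1) ^ 2 + (pf j (-1) ⬝ᵥ pf j 0) ^ 2) / 2 ≤ σi j := by
    intro j
    rw [hσod j, hσid j]
    have hg1 := hgap j 1 one_ne_zero
    have hgm := hgap j (-1) (by norm_num)
    exact slaving_weights_lower (by linarith) (by linarith [hd1 j, hd00 j]) (by linarith) (by linarith [hdm1 j, hd00 j])
  have hσoU : ∀ j, σo j ≤ 2 + 2 * rr := fun j => by rw [hσod j]; linarith [hσoF j, hrK j]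
  have hσo4 : ∀ j, σo j ≤ 28 := fun j => by linarith [hσoU j, hrr1]
  have hcos1 := fun j => dot_sq_div_freqNormSq_le_one ℓ (fun i => (W'.phase j).m i * (n : ℤ))
  have hσiU : ∀ j, σi j ≤ 2 * (((fun i => ((ℓ i : ℤ) : ℝ)) ⬝ᵥ (fun i => (((fun i => (W'.phase j).m i * (n : ℤ)) i : ℤ) : ℝ))) ^ 2 /
      (freqNormSq ℓ * freqNormSq (fun i => (W'.phase j).m i * (n : ℤ)))) + 26 * rr := fun j => by
    rw [hσid j]; linarith [hσiF j, hrK j]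
  have hσi28 : ∀ j, σi j ≤ 28 := fun j => by linarith [hσiU j, hcos1 j, hrr1]
  have hs1 : ∀ j, ∀ J : ℤ, (pf j J ⬝ᵥ pf j (J + 1)) ^ 2 ≤ 1 := fun j J => by
    have := hs j J
    rw [← sq_abs]; nlinarith [abs_nonneg (pf j J ⬝ᵥ pf j (J + 1))]
  have hγ0 : ∀ j, 0 ≤ γ j := fun j => by rw [hγd j]; exact Real.sqrt_nonneg _
  have hγsq : ∀ j, γ j ^ 2 = (pf j 0 ⬝ᵥ pf j 1) ^ 2 + (pf j (-1) ⬝ᵥ pf j 0) ^ 2 := fun j => by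
    rw [hγd j, Real.sq_sqrt (by positivity)]
  have hγ2 : ∀ j, γ j ^ 2 ≤ 2 := fun j => by
    rw [hγsq j]
    have h1 := hs1 j 0
    have h2 := hs1 j (-1)
    rw [zero_add] at h1
    rw [show (-1 : ℤ) + 1 = 0 by norm_num] at h2
    linarith
  have hσi0 : ∀ j, 0 ≤ σi j := fun j => le_trans (by positivity) (hσlow j).2
  have hσo0 : ∀ j, 0 ≤ σo j := fun j => le_trans zero_le_one (hσlow j).1
  -- small-parameter facts
  have hGδ4 : G ≤ δ / 10 ^ 4 := by
    rw [le_div_iff₀ (by norm_num)]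
    have : G * 10 ^ 4 * 1 ≤ G * 10 ^ 4 * M := mul_le_mul_of_nonneg_left (by linarith) (by positivity)
    linarith
  have hG1 : G ≤ 1 := hGδ4.trans (by rw [div_le_one (by norm_num)]; linarith)
  have hGδ : G ^ 2 ≤ δ / 10 ^ 4 := le_trans (by nlinarith) hGδ4
  -- the numeric hypotheses, slot by slot
  have hΛ : ∀ j, Λ j = ν / (n : ℝ) ^ 2 * (4 * Real.pi ^ 2 * freqNormSq (fun i => (W'.phase j).m i * (n : ℤ))) :=
    fun j => by rw [hΛd j, hfm j]; exact (hΛ' j).symm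
  have hg₁ : ∀ j, g j = 2 * Real.pi * (∑ i, (W'.phase j).e i * (ℓ i : ℝ)) *
      ‖Complex.exp ((W'.phase j).φ * Complex.I) *
        (1 / (2 * ((2 * Real.pi * ‖latticeVec (W'.phase j).m‖ : ℝ) : ℂ) * Complex.I))‖ * (1 / (n : ℝ)) / Λ j := by
    intro j
    rw [hgd j, hfe j, hfφ j, hΛ j, hfm j]
    exact (hg' j).symm
  have hβo : ∀ j, 2 ≤ β * Δ * ε * σo j := fun j => by rw [hβΔε]; linarith [(hσlow j).1]
  have hβi : ∀ j, γ j ^ 2 ≤ β * Δ * ε * σi j := fun j => by rw [hβΔε, hγsq j]; linarith [(hσlow j).2]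
  have hsmallo : ∀ j, g j ^ 2 * (4 * 2 / Δ + 2 * (1 + ε) * σo j) +
      2 * (4 * β * 2 * (Λ j * |g j| ^ 3 * σo j + |g j| / (W'.ramp * (W'.phase j).τ) + Λ j * |g j| ^ 2) ^ 2 /
        (Λ j * Δ ^ 3)) / Λ j ≤ Δ := fun j =>
    cell_hsmall (hcb j).1 hGs hδ hδ1 hM1 hεd (hσo0 j) (hσo4 j) (by norm_num) hΔd hβd hframp (hΛpos j) (hτpos j)
      (hΛτ j) (hcb j).2.2.2.1
  have hsmalli : ∀ j, g j ^ 2 * (4 * γ j ^ 2 / Δ + 2 * (1 + ε) * σi j) +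
      2 * (4 * β * γ j ^ 2 * (Λ j * |g j| ^ 3 * σi j + |g j| / (W'.ramp * (W'.phase j).τ) + Λ j * |g j| ^ 2) ^ 2 /
        (Λ j * Δ ^ 3)) / Λ j ≤ Δ := fun j =>
    cell_hsmall (hcb j).1 hGs hδ hδ1 hM1 hεd (hσi0 j) (hσi28 j) (hγ2 j) hΔd hβd hframp (hΛpos j) (hτpos j)
      (hΛτ j) (hcb j).2.2.2.1
  have hθo34 : ∀ j, 3 / 4 ≤ Real.exp (-(2 * Λ j * (W'.phase j).τ *
      (freqNormSq ℓ / freqNormSq (fun i => (W'.phase j).m i * (n : ℤ)) + (1 + ε) * σo j * (g j ^ 2 * (1 - 4 * W'.ramp / 3))) +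
      40 * β * 2 * Λ j * (W'.phase j).τ * g j ^ 4 * (1 + g j ^ 2 * σo j ^ 2) / Δ ^ 3 +
      48 * β * 2 * g j ^ 2 / (W'.ramp * (W'.phase j).τ * Λ j * Δ ^ 3))) := fun j =>
    cell_theta34 (hcb j).1 hGs hδ hδ1 hM1 hεd (hσo0 j) (hσo4 j) (by norm_num) (by norm_num) hΔd hβd hframp (hΛpos j)
      (hτpos j) (hΛτ j) (hcb j).2.2.2.1 (hTu j) (hcb j).2.1 (hd00 j) (hd0r j) hrr0 hrr
  have hθi34 : ∀ j, 3 / 4 ≤ Real.exp (-(2 * Λ j * (W'.phase j).τ *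
      (freqNormSq ℓ / freqNormSq (fun i => (W'.phase j).m i * (n : ℤ)) + (1 + ε) * σi j * (g j ^ 2 * (1 - 4 * W'.ramp / 3))) +
      40 * β * γ j ^ 2 * Λ j * (W'.phase j).τ * g j ^ 4 * (1 + g j ^ 2 * σi j ^ 2) / Δ ^ 3 +
      48 * β * γ j ^ 2 * g j ^ 2 / (W'.ramp * (W'.phase j).τ * Λ j * Δ ^ 3))) := fun j =>
    cell_theta34 (hcb j).1 hGs hδ hδ1 hM1 hεd (hσi0 j) (hσi28 j) (sq_nonneg _) (hγ2 j) hΔd hβd hframp (hΛpos j)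
      (hτpos j) (hΛτ j) (hcb j).2.2.2.1 (hTu j) (hcb j).2.1 (hd00 j) (hd0r j) hrr0 hrr
  have hθf : ∀ j, max (Real.exp (-(Λ j * Δ) * (W'.phase j).τ))
      (Real.exp (-(8 * Real.pi ^ 2 * (ν / (n : ℝ) ^ 2) * ((n : ℝ) / 2) ^ 2) * (W'.phase j).τ)) ≤ 1 / 4 := fun j =>
    cell_theta_fast (hΛτ j) (hcb j).2.2.2.1 (by linarith) (hslot j).2.2.2.2 hn' hν (hfτ j) hΔd
  have hcone := fun j => cell_cone_constant (hcb j).1 (hγ2 j) hΔd hβd hεd hδ hG1 hGδ hηd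
  -- isotropy
  obtain ⟨X, hXd⟩ : ∃ X : ℝ, X = 8 * Real.pi ^ 2 * freqNormSq ℓ * c0 * W'.period / (ν / (n : ℝ) ^ 2 * (n : ℝ) ^ 4) := ⟨_, rfl⟩
  have hWiso : IsotropicWordGain W' c0 := by rw [hW']; exact isotropicWordGain_cellWord hM (one_div_pos.mpr hν)
  have hiso : ∀ b : EuclideanSpace ℂ (Fin 3), ∑ i, ((ℓ i : ℤ) : ℂ) * b i = 0 →
      ∑ j, 2 * (2 * Λ j * (W'.phase j).τ * g j ^ 2) *
        (‖inner ℂ (WithLp.toLp 2 (Complex.ofReal ∘ ζr j) : EuclideanSpace ℂ (Fin 3)) b‖ ^ 2 +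
          ((fun i => ((ℓ i : ℤ) : ℝ)) ⬝ᵥ (fun i => (((fun i => (W'.phase j).m i * (n : ℤ)) i : ℤ) : ℝ))) ^ 2 /
              (freqNormSq ℓ * freqNormSq (fun i => (W'.phase j).m i * (n : ℤ))) *
            ‖inner ℂ (WithLp.toLp 2 (Complex.ofReal ∘ pf j 0) : EuclideanSpace ℂ (Fin 3)) b‖ ^ 2) = X * ‖b‖ ^ 2 := by
    intro b hb
    rw [hXd, ← upperSome_iso W' hWiso hn hκ hℓ ζr hζ1 hζ0 hζm pf hpf b hb]
    refine Finset.sum_congr rfl fun j _ => ?_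
    rw [hg₁ j, hΛ j]
  -- the data
  have hP := pvSetup_cell W' hn hκ.le ℓ (memSobolev_one_singleMode ℓ p) (isWeaklyDivFree_singleMode ℓ hp)
    (hasZeroMean_singleMode hℓ p) (mFourierCoeff_singleMode_eq_zero_of_not_sector ℓ p n)
  have hx0v : ‖hP.galerkinCoeffAt N 0 ℓ‖ ^ 2 = 1 / 4 := by
    rw [singleMode_galerkin_norm_sq_zero hℓ hP hℓN, hp1]; norm_num
  have hx0 : 0 < ‖hP.galerkinCoeffAt N 0 ℓ‖ ^ 2 := by rw [hx0v]; norm_num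
  have hcone0 : ∑ k ∈ freqBall N, ‖hP.galerkinCoeffAt N 0 k‖ ^ 2 - 2 * ‖hP.galerkinCoeffAt N 0 ℓ‖ ^ 2 ≤
      η * ‖hP.galerkinCoeffAt N 0 ℓ‖ ^ 2 := by
    rw [singleMode_galerkin_energy_zero hℓ hP hℓN, sub_self]; positivity
  -- the budget pieces
  have hY0 : 0 ≤ δ * M * G ^ 2 / Real.pi ^ 2 := by positivity
  have hslack : ∀ j, (40 * β * 2 * Λ j * (W'.phase j).τ * g j ^ 4 * (1 + g j ^ 2 * σo j ^ 2) / Δ ^ 3 +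
        48 * β * 2 * g j ^ 2 / (W'.ramp * (W'.phase j).τ * Λ j * Δ ^ 3)) +
      (40 * β * γ j ^ 2 * Λ j * (W'.phase j).τ * g j ^ 4 * (1 + g j ^ 2 * σi j ^ 2) / Δ ^ 3 +
        48 * β * γ j ^ 2 * g j ^ 2 / (W'.ramp * (W'.phase j).τ * Λ j * Δ ^ 3)) ≤ 3 / 13 * (δ * M * G ^ 2 / Real.pi ^ 2) := by
    intro j
    have h1 := cell_slack_le (hcb j).1 hGs hδ hδ1 hM1 hMδ hεd (hσo0 j) (hσo4 j) (by norm_num) (by norm_num) hΔd hβd hframp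
      (hΛpos j) (hτpos j) (hΛτ j) (hcb j).2.2.2.1 (hcb j).2.1 (c := 2)
    have h2 := cell_slack_le (hcb j).1 hGs hδ hδ1 hM1 hMδ hεd (hσi0 j) (hσi28 j) (sq_nonneg _) (hγ2 j) hΔd hβd hframp
      (hΛpos j) (hτpos j) (hΛτ j) (hcb j).2.2.2.1 (hcb j).2.1 (c := γ j ^ 2)
    linarith
  have hSl := Finset.sum_le_sum fun j (_ : j ∈ Finset.univ) => hslack j
  rw [Finset.sum_const, Finset.card_univ, Fintype.card_fin, nsmul_eq_mul, Nat.cast_ofNat] at hSl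
  have hβη' : 26 * (β * η) ≤ 3 * δ * M * G ^ 2 / Real.pi ^ 2 := cell_budget_eta hΔd hβd hεd hηd hδ hMδ
  have hAj : ∀ j, 2 * Λ j * (W'.phase j).τ * g j ^ 2 ≤ 5 * M * G ^ 2 / Real.pi ^ 2 := by
    intro j
    rw [show 2 * Λ j * (W'.phase j).τ * g j ^ 2 = 2 * ((Λ j * (W'.phase j).τ) * g j ^ 2) by ring, hΛτ j]
    have := (hcb j).2.1
    rw [show 5 * M * G ^ 2 / Real.pi ^ 2 = 2 * (5 * M * G ^ 2 / (2 * Real.pi ^ 2)) by ring]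
    linarith
  have hA26 := Finset.sum_le_sum fun j (_ : j ∈ Finset.univ) => hAj j
  rw [Finset.sum_const, Finset.card_univ, Fintype.card_fin, nsmul_eq_mul, Nat.cast_ofNat] at hA26
  have hA0 : 0 ≤ ∑ j, 2 * Λ j * (W'.phase j).τ * g j ^ 2 :=
    Finset.sum_nonneg fun j _ => by have := hΛpos j; have := hτpos j; positivity
  have hy : ν / (n : ℝ) ^ 2 * (4 * Real.pi ^ 2 * freqNormSq ℓ) * W'.period ≤ 1 := by
    rw [hfP, hAf]
    exact cell_heat_le_one hn' hν hM1 hδ1 (by positivity) (by rw [← hrd]; exact hrr) (by norm_num) le_rfl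
  have hxj : ∀ j, ν / (n : ℝ) ^ 2 * (4 * Real.pi ^ 2 * freqNormSq ℓ) * (W'.phase j).τ ≤ 1 := by
    intro j
    rw [hfτ j, hAf]
    exact cell_heat_le_one hn' hν hM1 hδ1 (by positivity) (by rw [← hrd]; exact hrr) (cubatureWord.phase j).τ_pos.le (hτle j)
  have hdrift : ∀ j, Real.exp (ν / (n : ℝ) ^ 2 * (4 * Real.pi ^ 2 * freqNormSq ℓ) * (W'.phase j).τ) *
      (Λ j * |g j| * (Real.sqrt 2 + γ j)) * (W'.phase j).τ ≤ 5 * (M * (cubatureWord.phase j).τ * G) := fun j =>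
    cell_drift_le (hxj j) (hΛpos j) (hτpos j) (hΛτ j) (hcb j).2.2.1 (hγ0 j) (hγ2 j)
  have hS := Finset.sum_le_sum fun j (_ : j ∈ Finset.univ) => hdrift j
  have hSv : ∑ j, 5 * (M * (cubatureWord.phase j).τ * G) = 18600 * (M * G) := by
    rw [show (fun j => 5 * (M * (cubatureWord.phase j).τ * G)) = fun j => (5 * M * G) * (cubatureWord.phase j).τ by
      funext j; ring, ← Finset.mul_sum, hτsum]
    ring
  rw [hSv] at hS
  have hS0 : 0 ≤ ∑ j, Real.exp (ν / (n : ℝ) ^ 2 * (4 * Real.pi ^ 2 * freqNormSq ℓ) * (W'.phase j).τ) *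
      (Λ j * |g j| * (Real.sqrt 2 + γ j)) * (W'.phase j).τ :=
    Finset.sum_nonneg fun j _ => by have := hΛpos j; have := hτpos j; have := hγ0 j; positivity
  have hκd := cell_kd_le hy hS0 hS hηd (hcb 0).1 hGs hδ1 hM1
  have hκd0 : 0 ≤ Real.exp (ν / (n : ℝ) ^ 2 * (4 * Real.pi ^ 2 * freqNormSq ℓ) * W'.period) *
      (∑ j, Real.exp (ν / (n : ℝ) ^ 2 * (4 * Real.pi ^ 2 * freqNormSq ℓ) * (W'.phase j).τ) *
        (Λ j * |g j| * (Real.sqrt 2 + γ j)) * (W'.phase j).τ) * Real.sqrt (3 * η) := by positivity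
  have hn0 : (n : ℝ) ≠ 0 := hn'.ne'
  have hν0 : ν ≠ 0 := hν.ne'
  have hc0v : c0 = 7 / (4960 * Real.pi ^ 4) := rfl
  have hXA : X = 8 * Real.pi ^ 2 * A ^ 2 * c0 * (M * 3720) / (ν ^ 2 * (n : ℝ) ^ 2) := by
    rw [hXd, hfP, hAf]; field_simp
  have hXv : X = 42 * M * G ^ 2 / Real.pi ^ 2 := by
    rw [hXA, hc0v, hGd]; field_simp; ring
  have hX0 : 0 ≤ X := by rw [hXv]; positivity
  have hB := cell_budget hεd hδ hδ1 hM1 hXv hSl hβη' hA0 hA26 hκd0 hκd hrr0 hrr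
  -- the Galerkin lower bound
  have key := upperSome_galerkin_lower W' hn hκ ℓ hℓn (memSobolev_one_singleMode ℓ p) (isWeaklyDivFree_singleMode ℓ hp)
    (hasZeroMean_singleMode hℓ p) (mFourierCoeff_singleMode_eq_zero_of_not_sector ℓ p n) hBN hk hdisj ζr hζ1 hζ0 hζK pf
    hpf Wset hW h0 h1 hm1 (fun j J _ => hs j J) Λ σo σi g γ Δ ε β hΛ hΔ0 hε0 hβ0
    (fun j J _ hJ => by rw [hΔd]; exact hgap j J hJ) hσod hσid hγsq hγ0 hg₁ hβo hβi hsmallo hsmalli hθo34 hθi34 hθf η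
    (fun j => (hcone j).1) (hcone 0).2.1 (hcone 0).2.2 rr X hrr0 hσoU hσiU hiso hcone0 hx0 ?_ t ht
  · -- from the Galerkin lower bound to the target rate
    rw [hx0v] at key
    have hP0 : 0 < W'.period := by rw [hfP]; positivity
    refine le_trans ?_ (key.trans (le_add_of_nonneg_right (sq_nonneg _)))
    rw [show (1 : ℝ) / 2 ^ 29 * Real.exp (-(8 * Real.pi ^ 2 * A ^ 2 *
        (1 + (1 + δ) * ((1 - 4 * cubatureWord.ramp / 3) * c0) / ν ^ 2) * ν / (n:ℝ) ^ 2) * t) =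
      1 / 4 * Real.exp (-(8 * Real.pi ^ 2 * A ^ 2 *
        (1 + (1 + δ) * ((1 - 4 * cubatureWord.ramp / 3) * c0) / ν ^ 2) * ν / (n:ℝ) ^ 2) * t) / 2 ^ 27 by ring]
    refine div_le_div_of_nonneg_right (mul_le_mul_of_nonneg_left (Real.exp_le_exp.2 ?_) (by norm_num)) (by positivity)
    rw [neg_mul, neg_mul, neg_le_neg_iff]
    refine mul_le_mul_of_nonneg_right ?_ ht
    rw [div_le_iff₀ hP0]
    -- `L ≤ rate · P″`
    have hrate : 8 * Real.pi ^ 2 * A ^ 2 * (1 + (1 + δ) * ((1 - 4 * cubatureWord.ramp / 3) * c0) / ν ^ 2) * ν /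
        (n:ℝ) ^ 2 * W'.period = 8 * Real.pi ^ 2 * A ^ 2 * M * 3720 / (n : ℝ) ^ 2 + (1 + δ) * (1 - 4 * (1 / 2 : ℝ) / 3) * X := by
      rw [hfP, hρ, hXA]; field_simp
    have hD : ∑ j, 2 * Λ j * (W'.phase j).τ * (freqNormSq ℓ / freqNormSq (fun i => (W'.phase j).m i * (n : ℤ))) =
        8 * Real.pi ^ 2 * A ^ 2 * M * 3720 / (n : ℝ) ^ 2 := by
      have hj : ∀ j, 2 * Λ j * (W'.phase j).τ * (freqNormSq ℓ / freqNormSq (fun i => (W'.phase j).m i * (n : ℤ))) =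
          8 * Real.pi ^ 2 * A ^ 2 * M / (n : ℝ) ^ 2 * (cubatureWord.phase j).τ := by
        intro j
        have hf0 : freqNormSq (cubatureWord.phase j).m ≠ 0 := by have := (hslot j).1; positivity
        rw [show 2 * Λ j * (W'.phase j).τ * (freqNormSq ℓ / freqNormSq (fun i => (W'.phase j).m i * (n : ℤ))) =
          2 * (Λ j * (W'.phase j).τ) * (freqNormSq ℓ / freqNormSq (fun i => (W'.phase j).m i * (n : ℤ))) by ring,
          hΛτ j, hTd j, hKf j, hAf]
        field_simp
        ring
      rw [Finset.sum_congr rfl fun j _ => hj j, ← Finset.mul_sum, hτsum]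
      ring
    rw [hrate, show (1 - 4 * W'.ramp / 3) = (1 - 4 * (1 / 2 : ℝ) / 3) by rw [hframp], Finset.sum_add_distrib,
      Finset.sum_add_distrib, hD, Finset.sum_const, Finset.card_univ, Fintype.card_fin, nsmul_eq_mul, Nat.cast_ofNat]
    rw [hεd] at hB ⊢
    nlinarith [hB, hX0, hδ.le]
  · -- `0 ≤ L`
    have hX0' : 0 ≤ X := hX0
    refine add_nonneg (Finset.sum_nonneg fun j _ => ?_) ?_
    · have := hΛpos j; have := hτpos j; have := hd00 j; have := hKf0 j
      have hr0 : 0 < W'.ramp := by rw [hframp]; norm_num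
      positivity
    · have hr3 : 0 ≤ 1 - 4 * W'.ramp / 3 := by rw [hframp]; norm_num
      exact mul_nonneg (mul_nonneg (by positivity) hr3) (add_nonneg hX0' (mul_nonneg (by positivity) hA0))

end Summit.AnomalousDissipation.AnomalousDissipation.Theorems.SolenoidalFractalHomogenisation.RealisedQuasiStaticCellLaw

end
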